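import Summits.HodgeConjecture.HodgeConjecture.Theorems.MarkmanPartnerTransportPicardThreeK3SquaresRMLociSquares
import HarnessLib

/-!
# Route MarkmanPartnerTransport · crux `PicardThreeK3Squares` (stmt-HodgeConjecture-19652) —
# HC⁴ of the HILBERT SQUARE `S^{[2]}` of every K3 surface on the ζ₉ and ζ₁₁ real-multiplication loci

Cell hodge-nonav; prover seat hodge-nonav-19652-p1 (gen 20); `--supports stmt-HodgeConjecture-19652`, helper. The
K3^[2]-type instances of the gen-20 capstone `…RMLociSquares` that need NO hyper-Kähler transport fact: for a K3
surface `S` on the ζ₉ ∕ ζ₁₁ locus, `HC⁴(S ⊗ S)` (capstone) descends to the Hilbert square `H = S^{[2]}` along the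
surjection `B_Δ(S × S) → S^{[2]}` (`Beauville1983_hilbertSquare_blowupDiagonal_surjection`; blow-up step +
`hodgeConjectureFor_of_tower_surjective_le_five` with `fulton1998_map_mem_algebraicClasses_holds`), exactly as in
gen 11's `hodgeConjectureFor_hilbertSquare_of_zeta11Type`. These `H` are smooth projective fourfolds of K3^[2]-type
with `ρ(H) = ρ(S) + 1 ∈ {11, 14, 17}` (ζ₉) ∕ `{3, 8, 13}` (ζ₁₁). CONDITIONAL on {`Buskin2019_hodgeIsometry_algebraic`,
`Huybrechts_K3_marking_exists`, the ∀-member van Geemen–Schütt fact, `Beauville1983_hilbertSquare_blowupDiagonal_surjection`};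
credits nothing; nothing here says HC is proved; rung F-H1 not moved.

* **`exists_zeta9Locus_hodgeConjectureFor_hilbertSquare`** — ∃ ζ₉ datum such that for every marked projective K3
  surface `S` whose period lies (after a rational isometry of `Λ_ℚ`) on the ζ₉ Hodge locus and every Hilbert square
  `H` of `S` (`IsHilbertSchemeOfPoints 2 S H Ξ`, `H` smooth projective of dimension `4`): `HodgeConjectureFor 4 H`.
* **`hodgeConjectureFor_hilbertSquare_of_zeta11Locus`** — the same on the ζ₁₁ locus, for every ζ₁₁ datum.

No definition, no sorry, no new named fact. References: Beauville, J. Differential Geom. 18 (1983) §6; van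
Geemen–Schütt, Forum Math. Sigma 13 (2025) e2, Thm. 1.1 (9), (11); Buskin, J. reine angew. Math. 755 (2019) Thm. 1.1;
Arapura, in *Motives, polylogarithms and Hodge theory* (2002), Lemmas 13 and 16.
-/

set_option linter.dupNamespace false

noncomputable section

namespace Summit.HodgeConjecture.HodgeConjecture.Theorems.MarkmanPartnerTransport.RMTypeOrbit

open CategoryTheory MonoidalCategory Polynomial
open Literature.AlgebraicGeometry Literature.AlgebraicGeometry.Motives Literature.AlgebraicGeometry.HodgeTheory
open Literature.AlgebraicGeometry.Surfaces Literature.LinearAlgebra.QuadraticForm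
open Literature.AlgebraicGeometry.Hyperkaehler Literature.AlgebraicGeometry.HilbertScheme
open Literature.AlgebraicTopology.SingularHomology
open Summit.HodgeConjecture.HodgeConjecture.Theorems.NikulinTwinTransport
open Summit.HodgeConjecture.HodgeConjecture.Theorems.MarkmanPartnerTransport.IsogenyInvariance
open Summit.HodgeConjecture.HodgeConjecture.Theorems.MarkmanPartnerTransport.RMTypeDescent

/-- `MarkedK3[S, η, p, x]`: VERBATIM the `let MarkedK3 := …` binder of the route declaration
`PicardThreeK3Squares` (as in `…RMTypeDescent`). Local notation only. -/
local notation3 (prettyPrint := false) "MarkedK3[" S ", " η ", " p ", " x "]" =>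
  (p ≠ 0 ∧ (IsIntegralClass p ∧
    (∀ q : complexBetti S (2 * 2), IsIntegralClass q → ∃ n : ℤ, q = n • p) ∧
    (∀ c : complexBetti S (2 * 1), IsIntegralClass c ↔ ∃ v : K3Index → ℤ, η c = fun i => (v i : ℂ)) ∧
    (∀ a b : complexBetti S (2 * 1),
      cupProduct (rfl : 2 * 1 + 2 * 1 = 2 * 2) a b = k3Form (η a) (η b) • p) ∧
    IsOfHodgeType 2 S (2 * 1) 2 0 (LinearEquiv.symm η x) ∧
    (∀ τ : complexBetti S (2 * 1), IsOfHodgeType 2 S (2 * 1) 2 0 τ →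
      ∃ t : ℂ, τ = t • LinearEquiv.symm η x)) ∧
    (k3Form x x = 0 ∧ 0 < (k3Form (star x) x).re ∧
      ∃ u : K3Index → ℤ, k3Form (fun i => (u i : ℂ)) x = 0 ∧ 0 < ∑ i, ∑ j, u i * k3Gram i j * u j))

/-- `Zeta9Model[g, y₀, θ]`: VERBATIM the datum conjuncts of the named fact
`VanGeemenSchuett2025_zeta9_cycleOnOpenPeriodSet` (as in `…Zeta9Type`). Local notation only. -/
local notation3 (prettyPrint := false) "Zeta9Model[" g ", " y₀ ", " θ "]" =>
  ((∀ a b : K3Index → ℂ, k3Form (g a) (g b) = k3Form a b) ∧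
    (∀ v : K3Index → ℤ, ∃ w : K3Index → ℤ,
      g (fun i => ((v i : ℤ) : ℂ)) = fun i => ((w i : ℤ) : ℂ)) ∧
    g ^ 9 = 1 ∧
    Module.finrank ℂ (LinearMap.ker (g ^ 3 - 1)) = 10 ∧
    k3Form y₀ y₀ = 0 ∧ 0 < (k3Form (star y₀) y₀).re ∧
    g y₀ = Complex.exp (2 * Real.pi * Complex.I / 9) • y₀ ∧
    (∀ y : K3Index → ℂ, thetaC θ y =
      (1 / 3 : ℂ) • ((2 : ℂ) • g y + (2 : ℂ) • (g ^ 8) y - (g ^ 2) y - (g ^ 4) y - (g ^ 5) y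
        - (g ^ 7) y)))

/-- `Zeta11Model[g, u₁, u₂, y₀, θ]`: VERBATIM the antecedents of the named fact
`VanGeemenSchuett2025_OguisoZhang2011_zeta11_cycleOnOpenPeriodSet` (as in `…PicardThreeK3SquaresZeta11Type`).
Local notation only. -/
local notation3 (prettyPrint := false) "Zeta11Model[" g ", " u₁ ", " u₂ ", " y₀ ", " θ "]" =>
  ((∀ a b : K3Index → ℂ, k3Form (g a) (g b) = k3Form a b) ∧
    (∀ v : K3Index → ℤ, ∃ w : K3Index → ℤ,
      g (fun i => ((v i : ℤ) : ℂ)) = fun i => ((w i : ℤ) : ℂ)) ∧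
    g ^ 11 = 1 ∧
    g (fun i => ((u₁ i : ℤ) : ℂ)) = (fun i => ((u₁ i : ℤ) : ℂ)) ∧
    g (fun i => ((u₂ i : ℤ) : ℂ)) = (fun i => ((u₂ i : ℤ) : ℂ)) ∧
    k3Form (fun i => ((u₁ i : ℤ) : ℂ)) (fun i => ((u₁ i : ℤ) : ℂ)) = 0 ∧
    k3Form (fun i => ((u₂ i : ℤ) : ℂ)) (fun i => ((u₂ i : ℤ) : ℂ)) = 0 ∧
    k3Form (fun i => ((u₁ i : ℤ) : ℂ)) (fun i => ((u₂ i : ℤ) : ℂ)) = 1 ∧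
    (∀ v : K3Index → ℤ, g (fun i => ((v i : ℤ) : ℂ)) = (fun i => ((v i : ℤ) : ℂ)) →
      ∃ m n : ℤ, v = m • u₁ + n • u₂) ∧
    k3Form y₀ y₀ = 0 ∧ 0 < (k3Form (star y₀) y₀).re ∧
    g y₀ = Complex.exp (2 * Real.pi * Complex.I / 11) • y₀ ∧
    (∀ y : K3Index → ℂ, thetaC θ y =
      g y + (g ^ 10) y - (2 * k3Form y (fun i => ((u₂ i : ℤ) : ℂ))) • (fun i => ((u₁ i : ℤ) : ℂ))
        - (2 * k3Form y (fun i => ((u₁ i : ℤ) : ℂ))) • (fun i => ((u₂ i : ℤ) : ℂ))))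

variable {g : Module.End ℂ (K3Index → ℂ)} {u₁ u₂ : K3Index → ℤ} {y₀ : K3Index → ℂ}
  {θ : Matrix K3Index K3Index ℚ}

/-- **HC⁴ of the Hilbert square of every K3 surface on the ζ₉ locus** (`ρ(S^{[2]}) ∈ {11, 14, 17}`): the
capstone `exists_zeta9Locus_hodgeConjectureFor_square` descended along the blow-up of the diagonal
(`Beauville1983_hilbertSquare_blowupDiagonal_surjection` + `hodgeConjectureFor_of_tower_surjective_le_five`).
CONDITIONAL on the four displayed facts; credits nothing; HC is NOT proved here.
[cite: Beauville1983, §6 (e)–(f), p. 766] [cite: GeemenSchutt2023, Thm. 1.1 (9) and §4.8]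
[cite: Arapura2001HodgeCyclesModuli, Lemma 13 and Lemma 16] [cite: Buskin2019, Thm. 1.1] -/
theorem exists_zeta9Locus_hodgeConjectureFor_hilbertSquare
    (hB : Buskin2019_hodgeIsometry_algebraic) (hmark : Huybrechts_K3_marking_exists)
    (hV : VanGeemenSchuett2025_zeta9_cycleOnOpenPeriodSet_everyMember)
    (hBea : Beauville1983_hilbertSquare_blowupDiagonal_surjection) :
    ∃ (g : Module.End ℂ (K3Index → ℂ)) (y₀ : K3Index → ℂ) (θ : Matrix K3Index K3Index ℚ),
      Zeta9Model[g, y₀, θ] ∧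
      ∀ (S H : SchemeOver ℂ) (hS : IsK3Surface S) (Ξ : (S ⊗ H).left.IdealSheafData)
        (_hHilb : IsHilbertSchemeOfPoints 2 S H Ξ) (_hH : IsSmoothProjective 4 H)
        (η : complexBetti S (2 * 1) ≃ₗ[ℂ] (K3Index → ℂ)) (p : complexBetti S (2 * 2)) (x : K3Index → ℂ)
        (_hM : MarkedK3[S, η, p, x])
        (σ : Module.End ℂ (K3Index → ℂ)) (_hσ : ∀ a b, k3Form (σ a) (σ b) = k3Form a b)
        (_hσrat : ∀ v : K3Index → ℤ, ∃ w : K3Index → ℚ, σ (fun i => (v i : ℂ)) = fun i => (w i : ℂ))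
        (_heig : thetaC θ (σ x) = (((2 * Real.cos (2 * Real.pi / 9) : ℝ)) : ℂ) • σ x),
        HodgeConjectureFor 4 H := by
  obtain ⟨g, y₀, θ, hZ, hsq⟩ := exists_zeta9Locus_hodgeConjectureFor_square hB hmark hV
  refine ⟨g, y₀, θ, hZ, ?_⟩
  intro S H hS Ξ hHilb hH η p x hM σ hσ hσrat heig
  have hS2 : IsSmoothProjective 2 S := hS.isSmoothProjective
  obtain ⟨B, b, ρ, hBl, hρs⟩ := hBea S hS2 H Ξ hHilb
  haveI := hρs
  exact hodgeConjectureFor_of_tower_surjective_le_five fulton1998_map_mem_algebraicClasses_holds (n := 4)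
    (by norm_num) (Relation.ReflTransGen.single (hBl.smoothBlowupStep (by norm_num))) hBl.top hH ρ
    (hsq S hS η p x hM σ hσ hσrat heig)

/-- **HC⁴ of the Hilbert square of every K3 surface on the ζ₁₁ locus** (`ρ(S^{[2]}) ∈ {3, 8, 13}`; `ρ = 3` is
cell (3,5) of crux #5, gen 11), for every ζ₁₁ datum: `hodgeConjectureFor_square_of_zeta11Locus` descended
along the blow-up of the diagonal. CONDITIONAL on the four displayed facts; credits nothing; HC is NOT proved here.
[cite: Beauville1983, §6 (e)–(f), p. 766] [cite: GeemenSchutt2023, Thm. 1.1 (11) and §4.8]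
[cite: OguisoZhang2011K3Order11, Thm. 1.5 (3)] [cite: Arapura2001HodgeCyclesModuli, Lemma 13 and Lemma 16] -/
theorem hodgeConjectureFor_hilbertSquare_of_zeta11Locus
    (hB : Buskin2019_hodgeIsometry_algebraic) (hmark : Huybrechts_K3_marking_exists)
    (hV : VanGeemenSchuett2025_OguisoZhang2011_zeta11_cycleOnOpenPeriodSet_everyMember)
    (hBea : Beauville1983_hilbertSquare_blowupDiagonal_surjection)
    (hZ : Zeta11Model[g, u₁, u₂, y₀, θ])
    {S H : SchemeOver ℂ} (hS : IsK3Surface S) {Ξ : (S ⊗ H).left.IdealSheafData}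
    (hHilb : IsHilbertSchemeOfPoints 2 S H Ξ) (hH : IsSmoothProjective 4 H)
    (η : complexBetti S (2 * 1) ≃ₗ[ℂ] (K3Index → ℂ)) (p : complexBetti S (2 * 2)) (x : K3Index → ℂ)
    (hM : MarkedK3[S, η, p, x])
    (σ : Module.End ℂ (K3Index → ℂ)) (hσ : ∀ a b, k3Form (σ a) (σ b) = k3Form a b)
    (hσrat : ∀ v : K3Index → ℤ, ∃ w : K3Index → ℚ, σ (fun i => (v i : ℂ)) = fun i => (w i : ℂ))
    (heig : thetaC θ (σ x) = (((2 * Real.cos (2 * Real.pi / 11) : ℝ)) : ℂ) • σ x) :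
    HodgeConjectureFor 4 H := by
  have hS2 : IsSmoothProjective 2 S := hS.isSmoothProjective
  obtain ⟨B, b, ρ, hBl, hρs⟩ := hBea S hS2 H Ξ hHilb
  haveI := hρs
  exact hodgeConjectureFor_of_tower_surjective_le_five fulton1998_map_mem_algebraicClasses_holds (n := 4)
    (by norm_num) (Relation.ReflTransGen.single (hBl.smoothBlowupStep (by norm_num))) hBl.top hH ρ
    (hodgeConjectureFor_square_of_zeta11Locus hB hmark hV hZ S hS η p x hM σ hσ hσrat heig)

end Summit.HodgeConjecture.HodgeConjecture.Theorems.MarkmanPartnerTransport.RMTypeOrbit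

end
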